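import Summits.SmoothPoincare4.SmoothPoincare4.Theorems.ConvexBisectionAcyclicBisectionExistsDualHandlePushTubeSelf
import Summits.SmoothPoincare4.SmoothPoincare4.Theorems.ConvexBisectionAcyclicBisectionExistsDualHandlePushRegion
import HarnessLib

/-!
# Dual handles, XVII: the image of the punctured ball under the tube self-push
(brick (PUSH-i) of the sub-goal T3b step (ii) "push the prefix sub-handlebody `X₁` off the cocore
neighbourhood `N` of the suffix handles" of stub `stub_steinRealisation` (NF6), line
`modp-braid-orbits` r11, crux `ConvexBisection.AcyclicBisectionExists`, item
stmt-SmoothPoincare4-10508; wave 3, lead c5, worker Z3)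

`S = selfPush κ δ` (`…DualHandlePushTubeSelf.lean`) is the push of `X₁` read in Kosinski's tube `T`
of the `j`-th attaching circle `γ`; `T ∩ X₁` is the punctured closed ball `{‖y‖ ≤ 1, y_λ ≠ 0}`
(which contains `γ = {‖y_λ‖ = 1, y_μ = 0}`).  Here: **its image**,

    S '' {‖y‖ ≤ 1, y_λ ≠ 0} = {x | ‖x‖ ≤ 1, 0 < ‖x_λ‖² < 1, (α x ∈ pushTarget κ δ ∨ (x_μ = 0 ∧ ‖x_λ‖² = 1 - pFun κ 0))}

(`image_selfPush_puncturedBall`): through `α` it is the push target of the handle chart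
(`…DualHandlePushImage.lean`; `= {‖·‖ ≤ 1, 0 ≤ H} ∖ C` by `…DualHandlePushRegion.lean`) together
with the circle `α(C) = S(γ)` (`selfPush_of_mem_circle`) — i.e. **`X₁' ∩ T = α⁻¹ {‖·‖ ≤ 1, 0 ≤ H}`**
(`image_selfPush_puncturedBall_modelH`: `S '' {‖y‖ ≤ 1, y_λ ≠ 0} = {‖x‖ ≤ 1, 0 < ‖x_λ‖² < 1, 0 ≤ H (α x)}`),
a set on which `0 < ‖x_λ‖² < 1`, so that `α` (hence the handle chart `Ξ ∘ α`) is smooth on all of it.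
Everything here is proved; no named facts.

## References
* J. Milnor, *Lectures on the h-cobordism theorem* (1965), §3 (dual handles). [MilnorHCobordism1965]
* A. A. Kosinski, *Differential Manifolds* (1993), VI §6, (6.1). [Kosinski1993]
-/

noncomputable section

-- the prescribed namespace `Summit.<P>.<Sub>.…` duplicates `SmoothPoincare4` (P = Sub)
set_option linter.dupNamespace false

open scoped Manifold ContDiff Topology

namespace Summit.SmoothPoincare4.SmoothPoincare4.Theorems.AcyclicBisectionExists.ModpBraidOrbits

open Set Function Metric
open Literature.Topology.FourManifolds Literature.Topology.FourManifolds.HandleAttachingMap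

namespace PushModel

section TubeImage

variable {κ δ : ℝ}

/-- `‖α y‖ ≤ 1` for `‖y‖ ≤ 1`, `0 < s < 1`. [cite: Kosinski1993, VI §6] -/
theorem norm_handleInversion_le_one_sOf {y : EuclideanSpace ℝ (Fin 4)} (hy : ‖y‖ ≤ 1) (h0 : 0 < sOf y)
    (h1 : sOf y < 1) : ‖handleInversion 2 y‖ ≤ 1 :=
  norm_handleInversion_le_one hy (by rwa [← sOf_eq_lamSq]) (by rwa [← sOf_eq_lamSq])

/-- On the closed ball `s ≤ 1`, and `s = 1` forces `y_μ = 0`. [folklore] -/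
theorem sOf_le_one_of_norm_le_one {y : EuclideanSpace ℝ (Fin 4)} (hy : ‖y‖ ≤ 1) :
    sOf y + muN y ≤ 1 ∧ (sOf y = 1 → muPart y = 0) := by
  have h := (norm_le_one_iff y).1 hy
  refine ⟨h, fun hs => (muPart_eq_zero_iff y).2 (le_antisymm (by linarith) (sq_nonneg _))⟩

/-- **The punctured ball off `γ`**: for `‖y‖ ≤ 1`, `0 < s < 1`: `S y` is in the punctured ball with
`0 < ‖(S y)_λ‖² < 1` and `α (S y) ∈ pushTarget`. [folklore] -/
theorem selfPush_mem_of_lt (hκ : 0 < κ) (hκ2 : κ ≤ 1 / 2) (hδ : 0 < δ) (hδ2 : δ ≤ 1 / 2) {y : EuclideanSpace ℝ (Fin 4)}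
    (hy : ‖y‖ ≤ 1) (h0 : 0 < sOf y) (h1 : sOf y < 1) :
    ‖selfPush κ δ y‖ ≤ 1 ∧ 0 < sOf (selfPush κ δ y) ∧ sOf (selfPush κ δ y) < 1 ∧
      handleInversion 2 (selfPush κ δ y) ∈ pushTarget κ δ := by
  have hx : lamPart (handleInversion 2 y) ≠ 0 := sOf_pos_iff.1 (by rw [sOf_handleInversion h0 h1.le]; linarith)
  have hmem := modelPush_mem_pushTarget hκ hκ2 hδ hδ2 hx (norm_handleInversion_le_one_sOf hy h0 h1)
  obtain ⟨hP0, hP1, -⟩ := sOf_modelPush_handleInversion hκ hκ2 (δ := δ) h0 h1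
  rw [selfPush_eq_in hκ hκ2 hδ h0 h1, sOf_handleInversion hP0 hP1.le, handleInversion_handleInversion_sOf hP0 hP1]
  exact ⟨norm_handleInversion_le_one_sOf hmem.1 hP0 hP1, by linarith, by linarith, hmem⟩

/-- **On `γ`**: `S y = √(1 - pFun κ 0) · (ŷ_λ, 0)` — the circle `α(C)` inside the ball. [folklore] -/
theorem selfPush_of_mem_circle (hκ : 0 < κ) (hκ2 : κ ≤ 1 / 2) (hδ : 0 < δ) {y : EuclideanSpace ℝ (Fin 4)}
    (h1 : ‖lamPart y‖ = 1) (h2 : muPart y = 0) :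
    selfPush κ δ y = Real.sqrt (1 - pFun κ 0) • lamEmbed (lamPart y) := by
  have hs : sOf y = 1 := by rw [sOf, h1, one_pow]
  have hy : y ∈ tubePushDom κ := circle_subset_tubePushDom hκ ⟨h1, h2⟩
  have hp : 0 < pFun κ 0 := pFun_pos hκ le_rfl
  have hc : sOf (Real.sqrt (pFun κ 0) • lamEmbed (lamPart y)) = pFun κ 0 := by
    rw [sOf, lamPart_smul, lamPart_lamEmbed, norm_sqrt_smul_sq hp.le, h1, one_pow, mul_one]
  rw [selfPush_eq_near hκ hκ2 hδ (by rw [hs]; linarith [pow_pos hκ 2]) hy, tubePush_of_mem_circle hκ h1 h2,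
    handleInversion_eq_torusScale, hc, torusScale, lamPart_smul, lamPart_lamEmbed, muPart_smul, muPart_lamEmbed,
    smul_zero, muEmbed_zero, smul_zero, add_zero, lamEmbed_smul, smul_smul, div_mul_cancel₀ _ (Real.sqrt_pos.2 hp).ne']

/-- `pFun κ 0 < 1`. [folklore] -/
theorem pFun_zero_lt_one (hκ : 0 < κ) (hκ2 : κ ≤ 1 / 2) : pFun κ 0 < 1 := by
  rw [pFun_zero]; nlinarith

/-- **THE IMAGE OF THE PUNCTURED BALL** (`= X₁' ∩ T` in tube coordinates). [folklore] -/
theorem image_selfPush_puncturedBall (hκ : 0 < κ) (hκ2 : κ ≤ 1 / 2) (hδ : 0 < δ) (hδ2 : δ ≤ 1 / 2) :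
    selfPush κ δ '' {y | ‖y‖ ≤ 1 ∧ lamPart y ≠ 0} =
      {x | ‖x‖ ≤ 1 ∧ 0 < sOf x ∧ sOf x < 1 ∧
        (handleInversion 2 x ∈ pushTarget κ δ ∨ (muPart x = 0 ∧ sOf x = 1 - pFun κ 0))} := by
  have hp : 0 < pFun κ 0 := pFun_pos hκ le_rfl
  have hp1 := pFun_zero_lt_one hκ hκ2
  refine Subset.antisymm ?_ ?_
  · rintro _ ⟨y, ⟨hy, hl⟩, rfl⟩
    have hs := sOf_pos_iff.2 hl
    obtain ⟨hsum, hγ⟩ := sOf_le_one_of_norm_le_one hy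
    rcases lt_or_ge (sOf y) 1 with h1 | h1
    · obtain ⟨a, b, c, d⟩ := selfPush_mem_of_lt hκ hκ2 hδ hδ2 hy hs h1
      exact ⟨a, b, c, Or.inl d⟩
    · -- `y ∈ γ`
      have hs1 : sOf y = 1 := by linarith [sq_nonneg ‖muPart y‖, show muN y = ‖muPart y‖ ^ 2 from rfl]
      have hl1 : ‖lamPart y‖ = 1 := by
        have : ‖lamPart y‖ ^ 2 = 1 := hs1
        nlinarith [norm_nonneg (lamPart y)]
      have hS := selfPush_of_mem_circle hκ hκ2 hδ hl1 (hγ hs1)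
      have hsS : sOf (selfPush κ δ y) = 1 - pFun κ 0 := by
        rw [hS, sOf, lamPart_smul, lamPart_lamEmbed, norm_sqrt_smul_sq (by linarith), hl1, one_pow, mul_one]
      have hmS : muPart (selfPush κ δ y) = 0 := by rw [hS, muPart_smul, muPart_lamEmbed, smul_zero]
      refine ⟨?_, by rw [hsS]; linarith, by rw [hsS]; linarith, Or.inr ⟨hmS, hsS⟩⟩
      rw [norm_le_one_iff, hsS, (muPart_eq_zero_iff _).1 hmS]; linarith
  · rintro x ⟨hx, h0, h1, h | ⟨hm, hs⟩⟩
    · -- through the handle chart: `x = S (α (sh⁻¹ (α x)))`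
      have hV := mem_pushInvDom_of_mem_pushTarget hκ hδ h
      set z := modelPushInv κ δ (handleInversion 2 x) with hz
      have hzl : lamPart z ≠ 0 := mapsTo_modelPushInv hκ hV
      have hzn : ‖z‖ ≤ 1 := norm_modelPushInv_le_one hκ hκ2 hδ h
      have hz0 : 0 < sOf z := sOf_pos_iff.2 hzl
      have hz1 : sOf z < 1 := by
        have hle : sOf z ≤ sOf (handleInversion 2 x) := by
          rw [hz, sOf_modelPushInv hκ hV]
          conv_rhs => rw [← pushP_pullLevel hκ hV]
          exact le_pushP hκ _ _
        rw [sOf_handleInversion h0 h1.le] at hle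
        linarith
      refine ⟨handleInversion 2 z, ⟨norm_handleInversion_le_one_sOf hzn hz0 hz1,
        sOf_pos_iff.1 (by rw [sOf_handleInversion hz0 hz1.le]; linarith)⟩, ?_⟩
      have hw0 : 0 < sOf (handleInversion 2 z) := by rw [sOf_handleInversion hz0 hz1.le]; linarith
      have hw1 : sOf (handleInversion 2 z) < 1 := by rw [sOf_handleInversion hz0 hz1.le]; linarith
      rw [selfPush_eq_in hκ hκ2 hδ hw0 hw1, handleInversion_handleInversion_sOf hz0 hz1, hz,
        modelPush_modelPushInv hκ hκ2 hδ hV, handleInversion_handleInversion_sOf h0 h1]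
    · -- on `α(C)`: `x = S (x̂_λ, 0)` with `(x̂_λ, 0) ∈ γ`
      have hl : lamPart x ≠ 0 := sOf_pos_iff.1 h0
      have hn : 0 < ‖lamPart x‖ := norm_pos_iff.2 hl
      set y : EuclideanSpace ℝ (Fin 4) := lamEmbed (‖lamPart x‖⁻¹ • lamPart x) with hy
      have hyl : lamPart y = ‖lamPart x‖⁻¹ • lamPart x := by rw [hy, lamPart_lamEmbed]
      have hym : muPart y = 0 := by rw [hy, muPart_lamEmbed]
      have hyl1 : ‖lamPart y‖ = 1 := by rw [hyl, norm_smul, norm_inv, norm_norm, inv_mul_cancel₀ hn.ne']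
      have hyn : ‖y‖ ≤ 1 := by
        rw [norm_le_one_iff, sOf, hyl1, show muN y = 0 by rw [muN, hym, norm_zero]; ring]; norm_num
      have hyl0 : lamPart y ≠ 0 := fun h0' => by rw [h0', norm_zero] at hyl1; exact zero_ne_one hyl1
      refine ⟨y, ⟨hyn, hyl0⟩, ?_⟩
      rw [selfPush_of_mem_circle hκ hκ2 hδ hyl1 hym, hyl, lamEmbed_smul, smul_smul]
      have hxs : Real.sqrt (1 - pFun κ 0) = ‖lamPart x‖ := by
        rw [← hs, sOf, Real.sqrt_sq (norm_nonneg _)]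
      rw [hxs, mul_inv_cancel₀ hn.ne', one_smul]
      conv_rhs => rw [← lamEmbed_add_muEmbed x, hm, muEmbed_zero, add_zero]

/-- `Q (α x) = 0 ↔ Q x = 0` and `P (α x) = 1 - P x` for `0 < P x < 1`. [cite: Kosinski1993, VI (6.1)] -/
theorem muPart_handleInversion_eq_zero_iff {x : EuclideanSpace ℝ (Fin 4)} (h0 : 0 < sOf x) (h1 : sOf x < 1) :
    muPart (handleInversion 2 x) = 0 ↔ muPart x = 0 := by
  rw [handleInversion_eq_torusScale, muPart_torusScale, smul_eq_zero, or_iff_right]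
  exact (div_pos (Real.sqrt_pos.2 h0) (Real.sqrt_pos.2 (by linarith))).ne'

/-- **`X₁' ∩ T = α⁻¹ {‖·‖ ≤ 1, 0 ≤ H}`**: the image of the punctured ball in terms of Z2's model function.
[folklore] -/
theorem image_selfPush_puncturedBall_modelH (hκ : 0 < κ) (hκ2 : κ ≤ 1 / 2) (hδ : 0 < δ) (hδ2 : δ ≤ 1 / 2) :
    selfPush κ δ '' {y | ‖y‖ ≤ 1 ∧ lamPart y ≠ 0} =
      {x | ‖x‖ ≤ 1 ∧ 0 < sOf x ∧ sOf x < 1 ∧ 0 ≤ modelH κ δ (handleInversion 2 x)} := by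
  rw [image_selfPush_puncturedBall hκ hκ2 hδ hδ2]
  ext x
  simp only [mem_setOf_eq]
  refine ⟨fun ⟨hx, h0, h1, h⟩ => ⟨hx, h0, h1, ?_⟩, fun ⟨hx, h0, h1, h⟩ => ⟨hx, h0, h1, ?_⟩⟩
  · rcases h with h | ⟨hm, hs⟩
    · rw [pushTarget_eq hκ hκ2 hδ hδ2] at h
      exact h.1.2
    · have hQ : muN (handleInversion 2 x) = 0 := by
        rw [← muPart_eq_zero_iff]; exact (muPart_handleInversion_eq_zero_iff h0 h1).2 hm
      rw [modelH_eq, hQ, modelHFun_of_le hδ (by linarith), zero_div, sOf_handleInversion h0 h1.le, hs]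
      simp
  · by_cases hC : muPart (handleInversion 2 x) = 0 ∧ sOf (handleInversion 2 x) = pFun κ 0
    · right
      exact ⟨(muPart_handleInversion_eq_zero_iff h0 h1).1 hC.1, by rw [← hC.2, sOf_handleInversion h0 h1.le]; ring⟩
    · left
      rw [pushTarget_eq hκ hκ2 hδ hδ2]
      exact ⟨⟨norm_handleInversion_le_one_sOf hx h0 h1, h⟩, hC⟩

end TubeImage

end PushModel

/-- **Registered helper `helper_image_selfPush` (brick (PUSH-i) of T3b (ii), sub-goal of NF6
`stub_steinRealisation`, wave 3, lead c5): the tube self-push `selfPush κ δ` maps the punctured closed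
ball `{‖y‖ ≤ 1, y_λ ≠ 0}` (= `T ∩ X₁`) ONTO `{‖x‖ ≤ 1, 0 < ‖x_λ‖² < 1, α x ∈ pushTarget κ δ ∨ x ∈ α(C)}`
(`α(C) = {x_μ = 0, ‖x_λ‖² = 1 - pFun κ 0} = selfPush (γ)`).** [folklore] -/
theorem helper_image_selfPush : ∀ {κ δ : ℝ}, 0 < κ → κ ≤ 1 / 2 → 0 < δ → δ ≤ 1 / 2 → Summit.SmoothPoincare4.SmoothPoincare4.Theorems.AcyclicBisectionExists.ModpBraidOrbits.PushModel.selfPush κ δ '' {y : EuclideanSpace ℝ (Fin 4) | ‖y‖ ≤ 1 ∧ Literature.Topology.FourManifolds.lamPart y ≠ 0} = {x : EuclideanSpace ℝ (Fin 4) | ‖x‖ ≤ 1 ∧ 0 < ‖Literature.Topology.FourManifolds.lamPart x‖ ^ 2 ∧ ‖Literature.Topology.FourManifolds.lamPart x‖ ^ 2 < 1 ∧ (Literature.Topology.FourManifolds.handleInversion 2 x ∈ Summit.SmoothPoincare4.SmoothPoincare4.Theorems.AcyclicBisectionExists.ModpBraidOrbits.PushModel.pushTarget κ δ ∨ (Literature.Topology.FourManifolds.muPart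 x = 0 ∧ ‖Literature.Topology.FourManifolds.lamPart x‖ ^ 2 = 1 - Summit.SmoothPoincare4.SmoothPoincare4.Theorems.AcyclicBisectionExists.ModpBraidOrbits.pFun κ 0))} ∧ (∀ y : EuclideanSpace ℝ (Fin 4), ‖Literature.Topology.FourManifolds.lamPart y‖ = 1 → Literature.Topology.FourManifolds.muPart y = 0 → Summit.SmoothPoincare4.SmoothPoincare4.Theorems.AcyclicBisectionExists.ModpBraidOrbits.PushModel.selfPush κ δ y = Real.sqrt (1 - Summit.SmoothPoincare4.SmoothPoincare4.Theorems.AcyclicBisectionExists.ModpBraidOrbits.pFun κ 0) • Literature.Topology.FourManifolds.lamEmbed (Literature.Topology.FourManifolds.lamPart y)) := by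
  intro κ δ hκ hκ2 hδ hδ2
  exact ⟨PushModel.image_selfPush_puncturedBall hκ hκ2 hδ hδ2, fun y h1 h2 => PushModel.selfPush_of_mem_circle hκ hκ2 hδ h1 h2⟩

end Summit.SmoothPoincare4.SmoothPoincare4.Theorems.AcyclicBisectionExists.ModpBraidOrbits

end
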